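import Summits.BirchSwinnertonDyer.BirchSwinnertonDyer.Theorems.ManinLocalTwoThreeEtaCoefficientTables
import Literature.Combinatorics.Enumerative.EulerPentagonalPowerSeries
import Literature.Combinatorics.Enumerative.InversionsExplicitFormula
import HarnessLib

/-!
# Fast `η`-table certificates: the Euler function's table by the pentagonal number theorem instead of a truncated product

Cell bsd-f2-manin, route `ManinLocalTwoThree` (cruxes C2 `ManinOddAtFour` stmt-22967 / C3 `ManinPrimeToThreeAtNine` stmt-22968),
prover seat p3 gen 25; a drop-in accelerator for an g53 / p2's kernel `η`-certificates (`…BracketSturmDefs`, `…EtaCoefficientTables`).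

THE BOTTLENECK.  A certificate `mulList M tab (etaDenList M N r) = etaNumList M N r a` is checked by `decide +kernel`; the lists are
built from `eulerScaledList M δ`, whose entries read `(EulerTables.eulerTruncList 1 M M).getD (n/δ) 0` — the kernel evaluates the
truncated product `∏_{m ≤ M}(1 − X^m)` lazily, at a cost growing like the cube of the largest index read, `≈ (M/δ)³`.  At the weight-12
Sturm depths `M = 145, 193, 217` of the levels `70, 88, 112, 126, 128, …` this passes only for `η`-quotients all of whose `δ` are `≥ 2` and
fails with «(kernel) excessive memory consumption» as soon as `η(τ)` itself occurs (measured at `M = 145`: `η₁η₂η₇η₁₄` alone fails, and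
so does the bare `eulerScaledList 145 1`).

THE FIX.  By Euler's pentagonal number theorem in its FINITE form (Hardy–Wright Thm. 353, the tree's
`Literature.Combinatorics.Enumerative.EulerPentagonal.coeff_prod_one_sub_X_pow_pentagonal` / `…_eq_zero`), the `n`-th coefficient of
`∏_{m ≤ M}(1 − X^m)` (`n ≤ M`) is `(−1)^k` if `n = k(3k−1)/2` for some `k ∈ ℤ` and `0` otherwise.  `pentCoeff n` computes exactly this by
a finite sum over `k ∈ [−n, n]` (Mathlib's `pentagonal`, `Int.negOnePow`) — `O(n)` kernel work per entry.  `eulerScaledListFast`,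
`eulerProdListFast`, `etaNumListFast`, `etaDenListFast` are the same lists as the engine's (PROVED equal, `…_eq`), so a certificate
stated with the fast lists (`qExpansion_coeff_eq_of_etaCertificateFast`) yields the engine's conclusion verbatim.

HONEST FRAMING: a kernel-evaluation device; no new mathematics beyond the cited finite pentagonal theorem; nothing here proves C2, C3,
Manin's conjecture or BSD.  The four `def`s are computable list functions (data for `decide`), no named fact, no sorry.
[cite: HardyWright2008, §19.9 Thm 353] [cite: Apostol1990, Thm. 14.3] [cite: Koehler2011, §2.1]
-/

set_option autoImplicit false
-- lint-debt: the directory name repeats the summit name (sibling precedent `ManinLocalTwoThreeEtaCoefficientTables.lean`)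
set_option linter.dupNamespace false

noncomputable section

open Complex Filter Topology Set Function
open UpperHalfPlane hiding I
open scoped Real Topology MatrixGroups ModularForm
open ModularForm CongruenceSubgroup PowerSeries Finset
open Literature.NumberTheory.ModularForms
open Literature.NumberTheory.EllipticCurves Literature.NumberTheory.EllipticCurves.ModularForms
open Literature.Combinatorics.Enumerative.EulerPentagonal

namespace Summit.BirchSwinnertonDyer.BirchSwinnertonDyer.Theorems.ManinLocalTwoThree.BracketSturm

/-! ## §1 The pentagonal coefficient -/

/-- **`pentCoeff n`** = `(−1)^k` if `n = pentagonal k` for some `k ∈ ℤ` (necessarily `|k| ≤ n`), else `0`: the `n`-th coefficient of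
`∏_{m≥1}(1 − X^m)`, computed by a finite sum. [cite: HardyWright2008, §19.9 Thm 353] -/
def pentCoeff (n : ℕ) : ℤ :=
  ∑ k ∈ Finset.Icc (-(n : ℤ)) n, if pentagonal k = n then ((k.negOnePow : ℤˣ) : ℤ) else 0

/-- **`pentCoeff n` is the `n`-th coefficient of `∏_{i<N}(1 − X^{i+1})` for `n ≤ N`** (finite pentagonal number theorem).
[cite: HardyWright2008, §19.9 Thm 353] -/
theorem pentCoeff_eq_coeff_prod {n N : ℕ} (hn : n ≤ N) :
    pentCoeff n = coeff n (∏ i ∈ range N, (1 - X ^ (i + 1) : ℤ⟦X⟧)) := by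
  unfold pentCoeff
  by_cases h : n ∈ Set.range pentagonal
  · obtain ⟨k, hk⟩ := h
    have hkN : pentagonal k ≤ N := hk ▸ hn
    rw [← hk, coeff_prod_one_sub_X_pow_pentagonal ℤ k hkN, Int.cast_id]
    rw [Finset.sum_eq_single k]
    · rw [if_pos rfl]
    · intro j _ hj
      rw [if_neg (fun h ↦ hj (pentagonal_injective h))]
    · intro hk'
      exfalso
      apply hk'
      have h1 : k.natAbs ≤ pentagonal k := Literature.Combinatorics.Enumerative.natAbs_le_pentagonal k
      rw [Finset.mem_Icc]
      omega
  · rw [coeff_prod_one_sub_X_pow_eq_zero ℤ hn h]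
    refine Finset.sum_eq_zero fun j _ ↦ ?_
    rw [if_neg]
    rintro hj
    exact h ⟨j, hj⟩

/-- `pentCoeff n = coeff n (eulerTrunc 1 N)` for `n ≤ N` (the engine's truncated product, exponent `1`). [folklore] -/
theorem pentCoeff_eq_coeff_eulerTrunc {n N : ℕ} (hn : n ≤ N) : pentCoeff n = coeff n (eulerTrunc 1 N) := by
  rw [pentCoeff_eq_coeff_prod hn, eulerTrunc]
  simp only [pow_one]

/-- **`pentCoeff n = (eulerTruncList 1 M M).getD n 0` for `n ≤ M`**: the fast entry equals the engine's table entry. [folklore] -/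
theorem pentCoeff_eq_getD_eulerTruncList {n M : ℕ} (hn : n ≤ M) :
    pentCoeff n = (EulerTables.eulerTruncList 1 M M).getD n 0 := by
  rw [EulerTables.getD_eulerTruncList hn, pentCoeff_eq_coeff_eulerTrunc hn]

/-! ## §2 The fast lists and their agreement with the engine's -/

/-- Fast version of `eulerScaledList M δ` (the first `M` coefficients of `∏_{n≥1}(1 − X^{δn})`). [cite: Apostol1990, Thm. 14.3] -/
def eulerScaledListFast (M δ : ℕ) : List ℤ :=
  (List.range M).map fun n ↦ if δ ∣ n then pentCoeff (n / δ) else 0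

/-- **`eulerScaledListFast = eulerScaledList`.** [folklore] -/
theorem eulerScaledListFast_eq (M δ : ℕ) : eulerScaledListFast M δ = eulerScaledList M δ := by
  unfold eulerScaledListFast eulerScaledList
  refine List.map_congr_left fun n hn ↦ ?_
  rw [List.mem_range] at hn
  split_ifs with hδ
  · rw [pentCoeff_eq_getD_eulerTruncList ((Nat.div_le_self n δ).trans hn.le)]
  · rfl

/-- Fast version of `eulerProdList`. [folklore] -/
def eulerProdListFast (M : ℕ) (s : ℕ → ℕ) : List ℕ → List ℤ
  | [] => oneList M
  | δ :: L => mulList M (powList M (eulerScaledListFast M δ) (s δ)) (eulerProdListFast M s L)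

/-- **`eulerProdListFast = eulerProdList`.** [folklore] -/
theorem eulerProdListFast_eq (M : ℕ) (s : ℕ → ℕ) : ∀ L : List ℕ, eulerProdListFast M s L = eulerProdList M s L
  | [] => rfl
  | δ :: L => by rw [eulerProdListFast, eulerProdList, eulerScaledListFast_eq, eulerProdListFast_eq M s L]

/-- Fast NUMERATOR table of the `η`-quotient `r` with `q`-shift `a`. [cite: Koehler2011, §2.1] -/
def etaNumListFast (M N : ℕ) (r : ℕ → ℤ) (a : ℕ) : List ℤ :=
  shiftList M a (eulerProdListFast M (fun δ ↦ (r δ).toNat) (divisorsList N))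

/-- Fast DENOMINATOR table. [cite: Koehler2011, §2.1] -/
def etaDenListFast (M N : ℕ) (r : ℕ → ℤ) : List ℤ :=
  eulerProdListFast M (fun δ ↦ (-r δ).toNat) (divisorsList N)

/-- **`etaNumListFast = etaNumList`.** [folklore] -/
theorem etaNumListFast_eq (M N : ℕ) (r : ℕ → ℤ) (a : ℕ) : etaNumListFast M N r a = etaNumList M N r a := by
  rw [etaNumListFast, etaNumList, eulerProdListFast_eq]

/-- **`etaDenListFast = etaDenList`.** [folklore] -/
theorem etaDenListFast_eq (M N : ℕ) (r : ℕ → ℤ) : etaDenListFast M N r = etaDenList M N r := by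
  rw [etaDenListFast, etaDenList, eulerProdListFast_eq]

/-! ## §3 The fast certificate lemma (same conclusion as `qExpansion_coeff_eq_of_etaCertificate`) -/

variable {N : ℕ} [NeZero N] {k : ℤ}

/-- **TABLES OF `η`-QUOTIENT MODULAR FORMS FROM A FAST KERNEL CERTIFICATE**: if `E ∈ M_k(Γ₀(N))` is the `η`-quotient with exponents
`r` (`q`-shift `a`, `Σ δ r_δ = 24a`) and the kernel checks `e·den = num (mod q^M)` with the FAST tables, then `e` lists the first `M`
`q`-expansion coefficients of `E`. [cite: Koehler2011, §2.1] [cite: HardyWright2008, §19.9 Thm 353] -/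
theorem qExpansion_coeff_eq_of_etaCertificateFast (E : ModularForm (Gamma0 N) k) (r : ℕ → ℤ)
    (hE : ∀ τ : ℍ, E τ = etaQuotient N r τ) (a : ℕ) (hS : ∑ δ ∈ N.divisors, (δ : ℤ) * r δ = 24 * a) {M : ℕ}
    (e : List ℤ) (hcert : mulList M e (etaDenListFast M N r) = etaNumListFast M N r a) :
    ∀ n < M, ((e.getD n 0 : ℤ) : ℂ) = (qExpansion 1 ⇑E).coeff n :=
  qExpansion_coeff_eq_of_etaCertificate E r hE a hS e (by rwa [etaDenListFast_eq, etaNumListFast_eq] at hcert)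

/-! ## §4 Kernel sanity checks -/

/-- The fast Euler table agrees with the engine's kernel table through degree `40` (kernel check of both). [folklore] -/
theorem eulerScaledListFast_forty : eulerScaledListFast 41 1 = EulerTables.eulerTruncList 1 40 40 := by
  decide +kernel

/-- The fast table of `∏(1 − qⁿ)` to depth `145` is evaluated by the kernel without difficulty (`145` entries). [folklore] -/
theorem length_eulerScaledListFast : (eulerScaledListFast 145 1).length = 145 := by
  decide +kernel

end Summit.BirchSwinnertonDyer.BirchSwinnertonDyer.Theorems.ManinLocalTwoThree.BracketSturm

end
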